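import Literature.MathematicalPhysics.QuantumFieldTheory.StrongCouplingActivities
import Literature.MathematicalPhysics.QuantumLattice.GaugeGroups
import Mathlib.LinearAlgebra.Trace
import Mathlib.LinearAlgebra.Projection
import Mathlib.Topology.Instances.Matrix
import HarnessLib

/-!
# Crux `IR` (stmt-QuantumFields-19354), line `tension-ratio`, input `PlaquetteFloorSC` — part 1:
# Haar averages of signed tensor representations are idempotents with natural trace

Pooled prover `ym-ir-line-pool-p3` (gen 3).  Helper module for item `stmt-QuantumFields-19354` (`--supports`; it closes
nothing).  Group-representation plumbing for the volume-uniform strong-coupling floor of the `π`-plaquette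
(`TensionRatioDefs.PlaquetteFloorSC`, §7): for a compact group `G` with Haar probability measure, continuous matrix
representations `π` (size `m`) and `ρ` (size `N`), and a sign pattern `t : ι → Bool`, the **signed tensor representation**
`σ_t(g) = π(g) ⊠ ⨂ᵢ ρ(g)^{(tᵢ)}` (`ρ^{(true)} = ρ`, `ρ^{(false)} = ρ̄` entrywise conjugate; index type `Fin m × (ι → Fin N)`,
no Kronecker API needed) is multiplicative, so its entrywise Haar average `P_t = ∫ σ_t(g) dg` satisfies `σ_t(h) P_t = P_t`,
`P_t² = P_t`, hence `tr P_t ∈ ℕ` (rank of an idempotent, `LinearMap.IsProj.trace`) and `tr P_t ≥ 1` when `P_t ≠ 0` (§1–§2).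
§3 is the bookkeeping identity
`∫ Re tr(π(g)K) · ∏ᵢ Re tr(ρ(g)Mᵢ) dg = 2^{-|ι|} ∑_t Re tr(P_t · (K ⊠ ⨂ᵢ Mᵢ^{(tᵢ)}))`
(expand `Re z = (z + z̄)/2` in every `ρ`-factor; `tr(A ⊠ B) = tr A · ∏ tr Bᵢ`; `(A ⊠ B)(C ⊠ D) = AC ⊠ (BᵢDᵢ)`), with the two
consequences used downstream (§4): if every `P_t` vanishes then so does every such integral, and
`∫ Re tr π(g) · (Re tr ρ(g))^{|ι|} dg = 2^{-|ι|} ∑_t tr P_t ≥ 0`, `> 0` as soon as one `P_t ≠ 0`.  This is the character-free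
form of «`E_Haar[χ_π χ_ρ^a χ̄_ρ^b]` is the (non-negative integer) multiplicity of `π̄` in `ρ^{⊗a} ⊗ ρ̄^{⊗b}`»
(Bröcker–tom Dieck II.4; Montvay–Münster §3.4 for its use in the strong-coupling expansion).  Everything is proved;
nothing here bears on the Yang–Mills mass gap.
-/

set_option autoImplicit false

noncomputable section

open MeasureTheory Finset
open Literature.MathematicalPhysics.QuantumFieldTheory (haarProbability)

namespace Summit.QuantumFields.YangMills.Cruxes.IR.TensionRatio.PlaquetteFloor

variable {G : Type*} [Group G] [TopologicalSpace G] [IsTopologicalGroup G] [CompactSpace G]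
  [MeasurableSpace G] [BorelSpace G]

/-! ## §1 Haar average of a multiplicative continuous matrix function -/

section Avg

variable {n : Type*} [Fintype n] [DecidableEq n]

/-- The entrywise Haar average `P_σ = ∫ σ(g) dg` of a matrix-valued function on `G`. -/
def haarAvg (σ : G → Matrix n n ℂ) : Matrix n n ℂ :=
  Matrix.of fun i j => ∫ g, σ g i j ∂haarProbability G

omit [Fintype n] [DecidableEq n] in
/-- Entries of a continuous matrix function on a compact group are Haar integrable. -/
theorem integrable_entry {σ : G → Matrix n n ℂ} (hσ : Continuous σ) (i j : n) :
    Integrable (fun g => σ g i j) (haarProbability G) :=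
  (hσ.matrix_elem i j).integrable_of_hasCompactSupport (HasCompactSupport.of_compactSpace _)

omit [DecidableEq n] in
/-- **Left absorption**: `σ(h) · P_σ = P_σ` for multiplicative continuous `σ` (left invariance of Haar measure). -/
theorem mul_haarAvg {σ : G → Matrix n n ℂ} (hσ : Continuous σ) (hmul : ∀ g h, σ (g * h) = σ g * σ h)
    (h : G) : σ h * haarAvg σ = haarAvg σ := by
  ext i k
  simp only [Matrix.mul_apply, haarAvg, Matrix.of_apply]
  calc ∑ j, σ h i j * ∫ g, σ g j k ∂haarProbability G
      = ∑ j, ∫ g, σ h i j * σ g j k ∂haarProbability G := by simp_rw [integral_const_mul]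
    _ = ∫ g, ∑ j, σ h i j * σ g j k ∂haarProbability G :=
        (integral_finsetSum _ fun j _ => (integrable_entry hσ j k).const_mul _).symm
    _ = ∫ g, σ (h * g) i k ∂haarProbability G := by
        refine integral_congr_ae (ae_of_all _ fun g => ?_)
        simp only [hmul, Matrix.mul_apply]
    _ = ∫ g, σ g i k ∂haarProbability G := integral_mul_left_eq_self (fun g => σ g i k) h

omit [DecidableEq n] in
/-- **Idempotency**: `P_σ² = P_σ`. -/
theorem haarAvg_mul_self {σ : G → Matrix n n ℂ} (hσ : Continuous σ) (hmul : ∀ g h, σ (g * h) = σ g * σ h) :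
    haarAvg σ * haarAvg σ = haarAvg σ := by
  have key : ∀ g i k, ∑ j, σ g i j * haarAvg σ j k = haarAvg σ i k := fun g i k => by
    have := congrArg (fun A : Matrix n n ℂ => A i k) (mul_haarAvg hσ hmul g)
    simpa only [Matrix.mul_apply] using this
  ext i k
  rw [Matrix.mul_apply]
  calc ∑ j, haarAvg σ i j * haarAvg σ j k
      = ∑ j, ∫ g, σ g i j * haarAvg σ j k ∂haarProbability G := by
        refine Finset.sum_congr rfl fun j _ => ?_
        simp only [haarAvg, Matrix.of_apply]
        rw [integral_mul_const]
    _ = ∫ g, ∑ j, σ g i j * haarAvg σ j k ∂haarProbability G :=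
        (integral_finsetSum _ fun j _ => (integrable_entry hσ i j).mul_const _).symm
    _ = ∫ _g, haarAvg σ i k ∂haarProbability G := integral_congr_ae (ae_of_all _ fun g => key g i k)
    _ = haarAvg σ i k := by simp

/-- **The trace of `P_σ` is a natural number** (the rank of the idempotent `P_σ`), and it is `≥ 1` when `P_σ ≠ 0`. -/
theorem exists_trace_haarAvg_eq_natCast {σ : G → Matrix n n ℂ} (hσ : Continuous σ)
    (hmul : ∀ g h, σ (g * h) = σ g * σ h) :
    ∃ r : ℕ, (haarAvg σ).trace = r ∧ (haarAvg σ ≠ 0 → 1 ≤ r) := by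
  set P := haarAvg σ with hPdef
  have hP : P * P = P := haarAvg_mul_self hσ hmul
  have hidem : IsIdempotentElem (Matrix.toLin' P) := by
    show Matrix.toLin' P * Matrix.toLin' P = Matrix.toLin' P
    rw [Module.End.mul_eq_comp, ← Matrix.toLin'_mul, hP]
  refine ⟨Module.finrank ℂ (LinearMap.range (Matrix.toLin' P)), ?_, ?_⟩
  · rw [← Matrix.trace_toLin'_eq, (LinearMap.IsIdempotentElem.isProj_range _ hidem).trace]
  · intro hne
    have hr : LinearMap.range (Matrix.toLin' P) ≠ ⊥ := by
      intro hbot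
      apply hne
      rw [LinearMap.range_eq_bot] at hbot
      exact Matrix.toLin'.injective (by rw [hbot, map_zero])
    exact Nat.one_le_iff_ne_zero.2 fun h0 => hr (Submodule.finrank_eq_zero.1 h0)

/-- The real part of `tr P_σ` is non-negative, and at least `1` when `P_σ ≠ 0`. -/
theorem trace_haarAvg_re_nonneg {σ : G → Matrix n n ℂ} (hσ : Continuous σ)
    (hmul : ∀ g h, σ (g * h) = σ g * σ h) :
    0 ≤ (haarAvg σ).trace.re ∧ (haarAvg σ ≠ 0 → 1 ≤ (haarAvg σ).trace.re) := by
  obtain ⟨r, hr, h1⟩ := exists_trace_haarAvg_eq_natCast hσ hmul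
  refine ⟨by rw [hr, Complex.natCast_re]; exact Nat.cast_nonneg r, fun hne => ?_⟩
  rw [hr, Complex.natCast_re]
  exact_mod_cast h1 hne

omit [DecidableEq n] in
/-- `∫ tr(σ(g) X) dg = tr(P_σ X)`. -/
theorem integral_trace_mul {σ : G → Matrix n n ℂ} (hσ : Continuous σ) (X : Matrix n n ℂ) :
    ∫ g, (σ g * X).trace ∂haarProbability G = (haarAvg σ * X).trace := by
  simp only [Matrix.trace, Matrix.diag, Matrix.mul_apply]
  rw [integral_finsetSum _ fun i _ => integrable_finsetSum _ fun j _ => (integrable_entry hσ i j).mul_const _]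
  refine Finset.sum_congr rfl fun i _ => ?_
  rw [integral_finsetSum _ fun j _ => (integrable_entry hσ i j).mul_const _]
  refine Finset.sum_congr rfl fun j _ => ?_
  rw [integral_mul_const]
  simp only [haarAvg, Matrix.of_apply]

omit [DecidableEq n] in
/-- `∫ Re tr(σ(g) X) dg = Re tr(P_σ X)`. -/
theorem integral_trace_mul_re {σ : G → Matrix n n ℂ} (hσ : Continuous σ) (X : Matrix n n ℂ) :
    ∫ g, (σ g * X).trace.re ∂haarProbability G = (haarAvg σ * X).trace.re := by
  have hint : Integrable (fun g => (σ g * X).trace) (haarProbability G) := by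
    simp only [Matrix.trace, Matrix.diag, Matrix.mul_apply]
    exact integrable_finsetSum _ fun i _ => integrable_finsetSum _ fun j _ =>
      (integrable_entry hσ i j).mul_const _
  rw [← integral_trace_mul hσ X]
  exact (integral_re hint)

end Avg

/-! ## §2 Signed tensor representations -/

section Tensor

variable {m N : ℕ} {ι : Type*} [Fintype ι] [DecidableEq ι]

/-- The `ι`-fold tensor `A ⊠ ⨂ᵢ Bᵢ`, on the index type `Fin m × (ι → Fin N)`:
`(A ⊠ B)_{(a,I),(b,J)} = A_{ab} ∏ᵢ (Bᵢ)_{Iᵢ Jᵢ}`. -/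
def tens (A : Matrix (Fin m) (Fin m) ℂ) (B : ι → Matrix (Fin N) (Fin N) ℂ) :
    Matrix (Fin m × (ι → Fin N)) (Fin m × (ι → Fin N)) ℂ :=
  Matrix.of fun x y => A x.1 y.1 * ∏ i, B i (x.2 i) (y.2 i)

/-- `(A ⊠ B)(C ⊠ D) = (AC) ⊠ (BᵢDᵢ)ᵢ`. -/
theorem tens_mul (A C : Matrix (Fin m) (Fin m) ℂ) (B D : ι → Matrix (Fin N) (Fin N) ℂ) :
    tens A B * tens C D = tens (A * C) (fun i => B i * D i) := by
  classical
  ext x y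
  simp only [tens, Matrix.mul_apply, Matrix.of_apply]
  rw [Fintype.sum_prod_type]
  have h2 : ∀ z1 : Fin m, ∑ z2 : ι → Fin N,
      (A x.1 z1 * ∏ i, B i (x.2 i) (z2 i)) * (C z1 y.1 * ∏ i, D i (z2 i) (y.2 i)) =
        (A x.1 z1 * C z1 y.1) * ∏ i, ∑ j, B i (x.2 i) j * D i j (y.2 i) := by
    intro z1
    rw [Fintype.prod_sum, Finset.mul_sum]
    refine Finset.sum_congr rfl fun z2 _ => ?_
    rw [Finset.prod_mul_distrib]
    ring
  simp_rw [h2]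
  rw [← Finset.sum_mul]

/-- `tr(A ⊠ B) = tr A · ∏ᵢ tr Bᵢ`. -/
theorem trace_tens (A : Matrix (Fin m) (Fin m) ℂ) (B : ι → Matrix (Fin N) (Fin N) ℂ) :
    (tens A B).trace = A.trace * ∏ i, (B i).trace := by
  classical
  simp only [Matrix.trace, Matrix.diag]
  rw [Fintype.sum_prod_type, Fintype.prod_sum, Finset.sum_mul_sum]
  rfl

omit [DecidableEq ι] in
/-- `1 ⊠ ⨂ᵢ 1 = 1`. -/
theorem tens_one : tens (1 : Matrix (Fin m) (Fin m) ℂ) (fun _ : ι => (1 : Matrix (Fin N) (Fin N) ℂ)) = 1 := by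
  ext x y
  simp only [tens, Matrix.of_apply, Matrix.one_apply]
  by_cases hxy : x = y
  · subst hxy; simp
  · rw [if_neg hxy]
    by_cases h1 : x.1 = y.1
    · have h2 : x.2 ≠ y.2 := fun h => hxy (Prod.ext h1 h)
      have : ∃ i, x.2 i ≠ y.2 i := by
        by_contra hall; push Not at hall; exact h2 (funext hall)
      obtain ⟨i, hi⟩ := this
      rw [Finset.prod_eq_zero (Finset.mem_univ i) (if_neg hi), mul_zero]
    · rw [if_neg h1, zero_mul]

/-- Signed copy of a matrix: `sgn true A = A`, `sgn false A = Ā` (entrywise complex conjugate). -/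
def sgn (b : Bool) (A : Matrix (Fin N) (Fin N) ℂ) : Matrix (Fin N) (Fin N) ℂ :=
  if b then A else A.map (starRingEnd ℂ)

/-- `sgn b` is multiplicative. -/
theorem sgn_mul (b : Bool) (A B : Matrix (Fin N) (Fin N) ℂ) : sgn b (A * B) = sgn b A * sgn b B := by
  cases b
  · simp only [sgn, Bool.false_eq_true, ↓reduceIte, Matrix.map_mul]
  · simp only [sgn, ↓reduceIte]

/-- `sgn b 1 = 1`. -/
theorem sgn_one (b : Bool) : sgn b (1 : Matrix (Fin N) (Fin N) ℂ) = 1 := by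
  cases b
  · simp only [sgn, Bool.false_eq_true, ↓reduceIte]
    exact Matrix.map_one _ (map_zero _) (map_one _)
  · simp only [sgn, ↓reduceIte]

/-- The trace of the signed copy: `tr A` or its conjugate. -/
theorem trace_sgn (b : Bool) (A : Matrix (Fin N) (Fin N) ℂ) :
    (sgn b A).trace = if b then A.trace else starRingEnd ℂ A.trace := by
  cases b
  · simp only [sgn, Bool.false_eq_true, ↓reduceIte, Matrix.trace, Matrix.diag, Matrix.map_apply, map_sum]
  · simp only [sgn, ↓reduceIte]

/-- The signed copies of `tr(AB)` sum to twice its real part: `∑_b tr(sgn b A · sgn b B) = 2 Re tr(AB)`. -/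
theorem sum_bool_trace_sgn_mul (A B : Matrix (Fin N) (Fin N) ℂ) :
    ∑ b : Bool, (sgn b A * sgn b B).trace = ((2 * (A * B).trace.re : ℝ) : ℂ) := by
  rw [Fintype.sum_bool, ← sgn_mul, ← sgn_mul, trace_sgn, trace_sgn]
  simp only [↓reduceIte, Bool.false_eq_true]
  exact Complex.add_conj _

/-- **The signed tensor representation** `σ_t(g) = π(g) ⊠ ⨂ᵢ ρ(g)^{(tᵢ)}`. -/
def sigma (π : G →* Matrix (Fin m) (Fin m) ℂ) (ρ : G →* Matrix (Fin N) (Fin N) ℂ) (t : ι → Bool) (g : G) :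
    Matrix (Fin m × (ι → Fin N)) (Fin m × (ι → Fin N)) ℂ :=
  tens (π g) (fun i => sgn (t i) (ρ g))

omit [TopologicalSpace G] [IsTopologicalGroup G] [CompactSpace G] [MeasurableSpace G] [BorelSpace G] in
/-- `σ_t` is multiplicative. -/
theorem sigma_mul (π : G →* Matrix (Fin m) (Fin m) ℂ) (ρ : G →* Matrix (Fin N) (Fin N) ℂ) (t : ι → Bool)
    (g h : G) : sigma π ρ t (g * h) = sigma π ρ t g * sigma π ρ t h := by
  simp only [sigma, map_mul, sgn_mul, tens_mul]

omit [IsTopologicalGroup G] [CompactSpace G] [MeasurableSpace G] [BorelSpace G] in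
/-- The entries of the signed copy of a continuous matrix function are continuous. -/
theorem continuous_sgn_entry (ρ : G →* Matrix (Fin N) (Fin N) ℂ) (hρ : Continuous ρ) (b : Bool) (c d : Fin N) :
    Continuous fun g => sgn b (ρ g) c d := by
  cases b
  · simp only [sgn, Bool.false_eq_true, ↓reduceIte, Matrix.map_apply]
    exact (Complex.continuous_conj).comp (hρ.matrix_elem c d)
  · simp only [sgn, ↓reduceIte]
    exact hρ.matrix_elem c d

omit [IsTopologicalGroup G] [CompactSpace G] [MeasurableSpace G] [BorelSpace G] [DecidableEq ι] in
/-- `σ_t` is continuous. -/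
theorem continuous_sigma (π : G →* Matrix (Fin m) (Fin m) ℂ) (ρ : G →* Matrix (Fin N) (Fin N) ℂ)
    (hπ : Continuous π) (hρ : Continuous ρ) (t : ι → Bool) :
    Continuous (sigma (ι := ι) π ρ t) := by
  refine continuous_matrix fun x y => ?_
  simp only [sigma, tens, Matrix.of_apply]
  exact (hπ.matrix_elem _ _).mul (continuous_finsetProd _ fun i _ => continuous_sgn_entry ρ hρ (t i) _ _)

/-! ## §3 The bookkeeping identity -/

/-- **Pointwise identity**: `Re tr(AK) ∏ᵢ Re tr(BMᵢ) = 2^{-|ι|} ∑_t Re tr((A ⊠ ⨂ B^{(tᵢ)})(K ⊠ ⨂ Mᵢ^{(tᵢ)}))`. -/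
theorem re_trace_mul_prod_eq (A K : Matrix (Fin m) (Fin m) ℂ) (B : Matrix (Fin N) (Fin N) ℂ)
    (M : ι → Matrix (Fin N) (Fin N) ℂ) :
    (A * K).trace.re * ∏ i, (B * M i).trace.re =
      (2⁻¹ : ℝ) ^ Fintype.card ι *
        ∑ t : ι → Bool, (tens A (fun i => sgn (t i) B) * tens K (fun i => sgn (t i) (M i))).trace.re := by
  classical
  -- each summand is `tr(AK) ∏ᵢ tr(sgn (B Mᵢ))`
  have hsum : ∀ t : ι → Bool,
      (tens A (fun i => sgn (t i) B) * tens K (fun i => sgn (t i) (M i))).trace =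
        (A * K).trace * ∏ i, (sgn (t i) B * sgn (t i) (M i)).trace := fun t => by
    rw [tens_mul, trace_tens]
  simp_rw [hsum]
  rw [← Complex.re_sum, ← Finset.mul_sum]
  -- `∑_t ∏ᵢ tr(sgn B sgn Mᵢ) = ∏ᵢ ∑_b tr(sgn b B sgn b Mᵢ) = ∏ᵢ 2 Re tr(B Mᵢ)`
  rw [← Fintype.prod_sum (fun i b => (sgn b B * sgn b (M i)).trace)]
  simp_rw [sum_bool_trace_sgn_mul]
  rw [← Complex.ofReal_prod, Complex.re_mul_ofReal, Finset.prod_mul_distrib, Finset.prod_const, Finset.card_univ]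
  have h2 : (2⁻¹ : ℝ) ^ Fintype.card ι * (2 : ℝ) ^ Fintype.card ι = 1 := by
    rw [← mul_pow, inv_mul_cancel₀ (two_ne_zero), one_pow]
  calc (A * K).trace.re * ∏ i, (B * M i).trace.re
      = ((2⁻¹ : ℝ) ^ Fintype.card ι * (2 : ℝ) ^ Fintype.card ι) *
          ((A * K).trace.re * ∏ i, (B * M i).trace.re) := by rw [h2, one_mul]
    _ = (2⁻¹ : ℝ) ^ Fintype.card ι * ((A * K).trace.re * ((2 : ℝ) ^ Fintype.card ι * ∏ i, (B * M i).trace.re)) := by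
        ring

/-- **The integrated identity**:
`∫ Re tr(π(g)K) ∏ᵢ Re tr(ρ(g)Mᵢ) dg = 2^{-|ι|} ∑_t Re tr(P_t (K ⊠ ⨂ᵢ Mᵢ^{(tᵢ)}))`, `P_t = ∫ σ_t`. -/
theorem integral_re_trace_mul_prod (π : G →* Matrix (Fin m) (Fin m) ℂ) (ρ : G →* Matrix (Fin N) (Fin N) ℂ)
    (hπ : Continuous π) (hρ : Continuous ρ) (K : Matrix (Fin m) (Fin m) ℂ) (M : ι → Matrix (Fin N) (Fin N) ℂ) :
    ∫ g, (π g * K).trace.re * ∏ i, (ρ g * M i).trace.re ∂haarProbability G =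
      (2⁻¹ : ℝ) ^ Fintype.card ι *
        ∑ t : ι → Bool, (haarAvg (sigma (ι := ι) π ρ t) * tens K (fun i => sgn (t i) (M i))).trace.re := by
  simp_rw [re_trace_mul_prod_eq]
  rw [integral_const_mul]
  congr 1
  have hint : ∀ t : ι → Bool, Integrable
      (fun g => (tens (π g) (fun i => sgn (t i) (ρ g)) * tens K (fun i => sgn (t i) (M i))).trace.re)
      (haarProbability G) := fun t => by
    have hc : Continuous fun g => (sigma (ι := ι) π ρ t g * tens K (fun i => sgn (t i) (M i))) :=
      (continuous_sigma π ρ hπ hρ t).mul continuous_const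
    have hc' : Continuous fun g => (sigma (ι := ι) π ρ t g * tens K (fun i => sgn (t i) (M i))).trace.re :=
      Complex.continuous_re.comp ((Continuous.matrix_trace hc))
    exact hc'.integrable_of_hasCompactSupport (HasCompactSupport.of_compactSpace _)
  rw [integral_finsetSum _ fun t _ => hint t]
  refine Finset.sum_congr rfl fun t _ => ?_
  exact integral_trace_mul_re (continuous_sigma π ρ hπ hρ t) _

/-! ## §4 Consequences: vanishing below the order, positivity at the order -/

/-- If every `P_t` (`t : ι → Bool`) vanishes, so does every integral `∫ Re tr(π(g)K) ∏ᵢ Re tr(ρ(g)Mᵢ) dg`. -/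
theorem integral_re_trace_mul_prod_eq_zero (π : G →* Matrix (Fin m) (Fin m) ℂ)
    (ρ : G →* Matrix (Fin N) (Fin N) ℂ) (hπ : Continuous π) (hρ : Continuous ρ)
    (h0 : ∀ t : ι → Bool, haarAvg (sigma (ι := ι) π ρ t) = 0) (K : Matrix (Fin m) (Fin m) ℂ)
    (M : ι → Matrix (Fin N) (Fin N) ℂ) :
    ∫ g, (π g * K).trace.re * ∏ i, (ρ g * M i).trace.re ∂haarProbability G = 0 := by
  rw [integral_re_trace_mul_prod π ρ hπ hρ K M]
  simp only [h0, Matrix.zero_mul, Matrix.trace_zero, Complex.zero_re, Finset.sum_const_zero, mul_zero]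

/-- **Positivity at the order**: `∫ Re tr π(g) · (Re tr ρ(g))^{|ι|} dg = 2^{-|ι|} ∑_t Re tr P_t ≥ 0`, and it is
`≥ 2^{-|ι|} > 0` as soon as one `P_t ≠ 0`. -/
theorem integral_re_trace_mul_pow_pos (π : G →* Matrix (Fin m) (Fin m) ℂ)
    (ρ : G →* Matrix (Fin N) (Fin N) ℂ) (hπ : Continuous π) (hρ : Continuous ρ)
    (h : ∃ t : ι → Bool, haarAvg (sigma (ι := ι) π ρ t) ≠ 0) :
    (2⁻¹ : ℝ) ^ Fintype.card ι ≤
      ∫ g, (π g).trace.re * ((ρ g).trace.re) ^ Fintype.card ι ∂haarProbability G := by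
  obtain ⟨t₀, ht₀⟩ := h
  have hid := integral_re_trace_mul_prod (ι := ι) π ρ hπ hρ 1 (fun _ => 1)
  simp only [Matrix.mul_one, Finset.prod_const, Finset.card_univ, sgn_one, tens_one] at hid
  rw [hid]
  have hnn : ∀ t : ι → Bool, 0 ≤ (haarAvg (sigma (ι := ι) π ρ t)).trace.re := fun t =>
    (trace_haarAvg_re_nonneg (continuous_sigma π ρ hπ hρ t) (sigma_mul π ρ t)).1
  have h1 : 1 ≤ (haarAvg (sigma (ι := ι) π ρ t₀)).trace.re :=
    (trace_haarAvg_re_nonneg (continuous_sigma π ρ hπ hρ t₀) (sigma_mul π ρ t₀)).2 ht₀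
  have hsum : 1 ≤ ∑ t : ι → Bool, (haarAvg (sigma (ι := ι) π ρ t)).trace.re :=
    le_trans h1 (Finset.single_le_sum (fun t _ => hnn t) (Finset.mem_univ t₀))
  calc (2⁻¹ : ℝ) ^ Fintype.card ι = (2⁻¹ : ℝ) ^ Fintype.card ι * 1 := (mul_one _).symm
    _ ≤ (2⁻¹ : ℝ) ^ Fintype.card ι * ∑ t : ι → Bool, (haarAvg (sigma (ι := ι) π ρ t)).trace.re :=
        mul_le_mul_of_nonneg_left hsum (by positivity)

end Tensor

end Summit.QuantumFields.YangMills.Cruxes.IR.TensionRatio.PlaquetteFloor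

end
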